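import Literature.NumberTheory.GelbartRogawski1991.LocalSplittingCMParabolicEigenfunctional
import Literature.NumberTheory.GelbartRogawski1991.LocalUnitarySplittingsCM

/-!
# The doubling principle UPSTAIRS: the eigenvalue of a finite sum `Σᵢ ω(gᵢ)` on a vector `f` with `Σᵢ ω(gᵢ) f = a·f` is the sum of the
# Siegel scalars `e(w₀ (gᵢ ⊕ 1) w₀)` as soon as the doubled parabolic eigenfunctional sees `f` (LOCAL SEAM of s23, inert package, organ (L24-b) (Λ-a))

Track B ∕ K2-LIT, hLiu418 = stmt-HodgeConjecture-24832; LEAD F0P6-plan (g11) «M-155g» (ii) ∕ «M-155i» ((L24-b) «eigenvalue of `T(t₁)` on `[𝟙_𝒪]`» by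
ROAD A′, UPSTAIRS — no coinvariants); words `K2/K2Liu-p01/g3/INERT-SOCKETS-v2.K2Liup01g3.md` §3, census K2 bus 2026-09-04 «(Λ-functional) CENSUS».
Helper (count-neutral, own head per LEAD R3).  THEOREMS ONLY (no `def`, no instance, no notation, no named fact, no `sorry`).

The tree's ★ `LocalUnitaryUndoublingQuotientScalar` ∕ ★ `LocalSplittingCMParabolicEigenfunctional` prove the doubling principle at KER-LEVEL (a Schur input on
`r_N(ω)`); this file is its UPSTAIRS twin, with the Schur input replaced by an eigen-equation `Σᵢ ω(gᵢ) f = a · f` for ONE vector (road use: `f = 1_{𝒪^{n}}`,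
the `gᵢ` a transversal of `K_v t₁ K_v ∕ K_v`, `a` the spherical Hecke eigenvalue, by K2Liu-p05's (L24-a) line `ω_v^{K_v} = ℂ·1_{𝒪^n}`):
* §1 GROUP LEVEL (any quadratic `E ∕ F`, any doubled splitting `s` over `ι^𝔻`, any `ch : G →* U(J)(F_v)`, any linear functional `lam` on `𝒮(F_v^{n+n})`):
  `apply_boxSB_toRep_undoubleLoc_eq_mul` — an eigen-law `lam (ω^𝔻(s(ch t ⊕ 1)) Φ) = e · lam Φ` reads on products as
  `lam ((ω(undoubleLoc s (ch t)) f₁) ⊠ f₂) = e · lam (f₁ ⊠ f₂)` (★ `toRep_undoubleLoc_boxSB`); **`eq_sum_of_sum_toRep_undoubleLoc_eq_smul`** — if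
  `Σ_{i∈S} ω(undoubleLoc s (ch tᵢ)) f = a • f`, each `tᵢ` has eigen-scalar `eᵢ`, and `lam (f ⊠ f₂) ≠ 0` for some `f₂`, then `a = Σ_{i∈S} eᵢ`.
* §2 CM-DATUM LAYER (★ `localSplittingCMWith L n hT₀ hT₀d hJ χ hχ v μ = undoubleLoc s^𝔻`, `s^𝔻 = (localSplittingDatumCM …).localSplitting`, the functional
  `λ′ Φ = (ω^𝔻(m₀ · s^𝔻 w₀) Φ)(0)` of ★ `apply_zero_toRep_mul_localSplitting_eq_mul`): `apply_zero_boxSB_toRep_localSplittingCMWith_eq_mul` (eigen on products for every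
  `g` with `w₀ (ch g ⊕ 1) w₀ ∈ P_Δ`, scalar `e(p) = (chiDet χ⁻¹ p)⁻¹ · Π_{w'} √‖det_Δ p_{w'}‖`) and **`eq_sum_scalar_of_sum_toRep_localSplittingCMWith_eq_smul`** —
  THE EXTRACTION: `a = Σ_{i∈S} e(w₀ (ch tᵢ ⊕ 1) w₀)` provided `λ′(f ⊠ f₂) ≠ 0` for some `f₂` (the non-vanishing is (Λ-b), ★-derivable at a good place).
[Kudla1994, §3 Thm. 3.1]; [HarrisKudlaSweet1996, §1 (1.15)–(1.16)]; [GelbartRogawski1991, §3.2 (3.2.2) p. 457]; [MoeglinVignerasWaldspurger1987, Chap. 2 II.1 Rem. (6)].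
HONEST LABEL: HC_CM is proved only modulo the printed citations (2 remaining named inputs: hLiu418 = stmt-HodgeConjecture-24832, h413 =
stmt-HodgeConjecture-24833) until rung 0 closes; this file is unconditional and moves no counter.
-/

set_option autoImplicit false

set_option linter.dupNamespace false

noncomputable section

open scoped Matrix
open NumberField IsDedekindDomain MeasureTheory Matrix
open Literature.RepresentationTheory.HeisenbergGroup
open Literature.NumberTheory.Automorphic Literature.NumberTheory.Automorphic.UnitaryGroup Literature.NumberTheory.Weil1964
open Literature.NumberTheory.GaloisRepresentations Literature.RepresentationTheory.HarrisKudlaSweet1996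
open Literature.NumberTheory.GelbartRogawski1991 Literature.NumberTheory.GelbartRogawski1991.UnitaryDualPair
open Literature.NumberTheory.GelbartRogawski1991.UnitaryDualPair.LocalSplitting

namespace Summit.HodgeConjecture.HodgeConjecture.Cruxes.HLiu418.K2LiuDoublingEigenfunctionalUpstairs

/-! ## §1 Group level: an eigenfunctional of the doubled representation reads eigenvalues of finite sums upstairs -/

section GroupLevel

variable (F : Type) [Field F] [NumberField F] (E : Type) [Field E] [NumberField E] [Algebra F E] (c : E ≃ₐ[F] E)
  (v : HeightOneSpectrum (𝓞 F)) (n : ℕ) {T₀ : Matrix (Fin n) (Fin n) F}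
  {J : Matrix (Fin n) (Fin n) E} (hJ : J = T₀.map (algebraMap F E))
  {JD : Matrix (Fin (n + n)) (Fin (n + n)) E} (hJD : JD = (gramD F n T₀).map (algebraMap F E))
  [Algebra.IsQuadraticExtension F E] {δ : E} (hcδ : c δ = -δ) (hδ : δ ≠ 0) {d : F} (hd : δ * δ = algebraMap F E d)
  (hT₀ : T₀.IsSymm) (hT₀d : IsUnit T₀.det)
  (s : UnitaryGroup.localPi E c (n + n) JD v →* LocalMp F (n + n) (gramD F n T₀) v)
  (hs : ∀ g, MpPsi.proj _ (s g) = iota F E c (n + n) hcδ hδ hd (gramD F n T₀) (gramD_isSymm F n hT₀) hJD v g)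
  {G : Type*} [Group G] (ch : G →* UnitaryGroup.localPi E c n J v)
  (lam : SchwartzBruhat (Fin (n + n) → v.adicCompletion F) →ₗ[ℂ] ℂ)

/-- **an eigen-law of the doubled functional reads on products**: `lam (ω^𝔻(s(ch t ⊕ 1)) Φ) = e · lam Φ` for all `Φ` gives
`lam ((ω(undoubleLoc s (ch t)) f₁) ⊠ f₂) = e · lam (f₁ ⊠ f₂)` (★ `toRep_undoubleLoc_boxSB`). [cite: MoeglinVignerasWaldspurger1987, Chap. 2 II.1 Rem. (6)]
[cite: Kudla1994, §3 Thm. 3.1] -/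
theorem apply_boxSB_toRep_undoubleLoc_eq_mul (t : G) (e : ℂ)
    (heig : ∀ Φ : SchwartzBruhat (Fin (n + n) → v.adicCompletion F),
      lam (MpPsi.toRep (localSchrodinger F (n + n) (gramD F n T₀) v) (s (inlLoc F E c v n hJ hJD (ch t))) Φ) = e * lam Φ)
    (f₁ f₂ : SchwartzBruhat (Fin n → v.adicCompletion F)) :
    lam (boxSB (v.adicCompletion F) (e₂ n)
        (MpPsi.toRep (localSchrodinger F n T₀ v) (undoubleLoc F E c v n hJ hJD hcδ hδ hd hT₀ hT₀d s hs (ch t)) f₁) f₂) =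
      e * lam (boxSB (v.adicCompletion F) (e₂ n) f₁ f₂) := by
  rw [← toRep_undoubleLoc_boxSB F E c v n hJ hJD hcδ hδ hd hT₀ hT₀d s hs (ch t) f₁ f₂, heig]

/-- **THE DOUBLING PRINCIPLE, UPSTAIRS (group level).**  If `Σ_{i∈S} ω(undoubleLoc s (ch tᵢ)) f = a • f`, every `tᵢ` satisfies the eigen-law of `lam`
with scalar `eᵢ`, and `lam (f ⊠ f₂) ≠ 0` for some `f₂`, then **`a = Σ_{i∈S} eᵢ`**: apply the linear functional `f₁ ↦ lam (f₁ ⊠ f₂)` to the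
eigen-equation and cancel `lam (f ⊠ f₂)`. [cite: Kudla1994, §3 Thm. 3.1] [cite: GelbartRogawski1991, §3.2 (3.2.2) p. 457] -/
theorem eq_sum_of_sum_toRep_undoubleLoc_eq_smul {ι : Type*} (S : Finset ι) (t : ι → G) (e : ι → ℂ)
    (heig : ∀ i ∈ S, ∀ Φ : SchwartzBruhat (Fin (n + n) → v.adicCompletion F),
      lam (MpPsi.toRep (localSchrodinger F (n + n) (gramD F n T₀) v) (s (inlLoc F E c v n hJ hJD (ch (t i)))) Φ) = e i * lam Φ)
    (f : SchwartzBruhat (Fin n → v.adicCompletion F)) (a : ℂ)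
    (hsum : ∑ i ∈ S, MpPsi.toRep (localSchrodinger F n T₀ v) (undoubleLoc F E c v n hJ hJD hcδ hδ hd hT₀ hT₀d s hs (ch (t i))) f = a • f)
    (f₂ : SchwartzBruhat (Fin n → v.adicCompletion F)) (hne : lam (boxSB (v.adicCompletion F) (e₂ n) f f₂) ≠ 0) :
    a = ∑ i ∈ S, e i := by
  -- the slice functional `f₁ ↦ lam (f₁ ⊠ f₂)`
  let ℓ : SchwartzBruhat (Fin n → v.adicCompletion F) →ₗ[ℂ] ℂ :=
    lam ∘ₗ (sumEquivSB (v.adicCompletion F) (e₂ n)).toLinearMap ∘ₗ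
      (TensorProduct.mk ℂ (SchwartzBruhat (Fin n → v.adicCompletion F)) (SchwartzBruhat (Fin n → v.adicCompletion F))).flip f₂
  have hℓ : ∀ f₁, ℓ f₁ = lam (boxSB (v.adicCompletion F) (e₂ n) f₁ f₂) := fun f₁ => by
    change lam (sumEquivSB (v.adicCompletion F) (e₂ n) (f₁ ⊗ₜ f₂)) = _
    rw [sumEquivSB_tmul]
  have h1 : ℓ (∑ i ∈ S, MpPsi.toRep (localSchrodinger F n T₀ v) (undoubleLoc F E c v n hJ hJD hcδ hδ hd hT₀ hT₀d s hs (ch (t i))) f) =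
      (∑ i ∈ S, e i) * ℓ f := by
    rw [map_sum, Finset.sum_mul]
    refine Finset.sum_congr rfl fun i hi => ?_
    rw [hℓ, hℓ, apply_boxSB_toRep_undoubleLoc_eq_mul F E c v n hJ hJD hcδ hδ hd hT₀ hT₀d s hs ch lam (t i) (e i) (heig i hi)]
  rw [hsum, map_smul, smul_eq_mul, hℓ] at h1
  exact mul_right_cancel₀ hne h1

end GroupLevel

/-! ## §2 The CM-datum layer: `λ′ = ev₀ ∘ ω^𝔻(m₀ · s^𝔻 w₀)` and `s_v = localSplittingCMWith = undoubleLoc s^𝔻` -/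

section CM

variable (L : Type) [Field L] [NumberField L] [IsCMField L] (v : HeightOneSpectrum (𝓞 (maximalRealSubfield L)))
  [MeasurableSpace (v.adicCompletion (maximalRealSubfield L))] [BorelSpace (v.adicCompletion (maximalRealSubfield L))]
  (μ : Measure (v.adicCompletion (maximalRealSubfield L))) [μ.IsAddHaarMeasure]
  (n : ℕ) {T₀ : Matrix (Fin n) (Fin n) (maximalRealSubfield L)} (hT₀ : T₀.IsSymm) (hT₀d : IsUnit T₀.det)
  {J : Matrix (Fin n) (Fin n) L} (hJ : J = T₀.map (algebraMap (maximalRealSubfield L) L))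
  (χ : HeckeCharacter L) (hχ : IsSplittingChar L 1 χ)
  (m₀ : LocalMp (maximalRealSubfield L) (n + n) (gramD (maximalRealSubfield L) n T₀) v)
  (hm₀ : (deltaLagrangian (maximalRealSubfield L) v n).map (toLin (maximalRealSubfield L) v (MpPsi.proj _ m₀)) =
    lagrangianY (maximalRealSubfield L) (n + n) v)
  (w₀ : UnitaryGroup.localPi L (IsCMField.complexConj L) (n + n)
    ((gramD (maximalRealSubfield L) n T₀).map (algebraMap (maximalRealSubfield L) L)) v)
  (hw₀ : w₀ * w₀ = 1)
  {G : Type*} [Group G] (ch : G →* UnitaryGroup.localPi L (IsCMField.complexConj L) n J v)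

/-- `s_v = localSplittingCMWith … v μ` IS the undoubling of the doubled CM datum's splitting (definitional). [cite: GelbartRogawski1991, §3.1 Prop. 3.1.1 p. 455 L1–3] -/
theorem localSplittingCMWith_eq_undoubleLoc :
    localSplittingCMWith L n hT₀ hT₀d hJ χ hχ v μ =
      undoubleLoc (maximalRealSubfield L) L (IsCMField.complexConj L) v n hJ rfl (complexConj_imagUnit L) (imagUnit_ne_zero L)
        (imagUnit_mul_self L) hT₀ hT₀d (localSplittingDatumCM L v μ n hT₀ hT₀d rfl χ hχ).localSplitting
        fun g => (localSplittingDatumCM L v μ n hT₀ hT₀d rfl χ hχ).proj_localSplitting g := rfl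

include hm₀ hw₀ in
set_option maxHeartbeats 4000000 in -- the doubled CM datum's telescope (as ★ `LocalSplittingCMParabolicEigenfunctional`)
/-- **EIGEN ON PRODUCTS for the CM datum**: for `g` with `w₀ (ch g ⊕ 1) w₀ ∈ P_Δ`,
`λ′((ω(s_v (ch g)) f₁) ⊠ f₂) = e(w₀ (ch g ⊕ 1) w₀) · λ′(f₁ ⊠ f₂)`, `λ′ Φ = (ω^𝔻(m₀ · s^𝔻 w₀) Φ)(0)`, `e(p) = (chiDet χ⁻¹ p)⁻¹ · Π_{w'} √‖det_Δ p_{w'}‖`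
(★ `apply_zero_toRep_mul_localSplitting_eq_mul` + ★ `toRep_undoubleLoc_boxSB`). [cite: Kudla1994, §3 Thm. 3.1] [cite: HarrisKudlaSweet1996, §1 (1.16)] -/
theorem apply_zero_boxSB_toRep_localSplittingCMWith_eq_mul (g : G)
    (hg : IsSiegelDelta (maximalRealSubfield L) L (IsCMField.complexConj L) (complexConj_imagUnit L) (imagUnit_ne_zero L)
        (imagUnit_mul_self L) v n hT₀ rfl (w₀ * inlLoc (maximalRealSubfield L) L (IsCMField.complexConj L) v n hJ rfl (ch g) * w₀))
    (f₁ f₂ : SchwartzBruhat (Fin n → v.adicCompletion (maximalRealSubfield L))) :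
    ((MpPsi.toRep (localSchrodinger (maximalRealSubfield L) (n + n) (gramD (maximalRealSubfield L) n T₀) v)
          (m₀ * (localSplittingDatumCM L v μ n hT₀ hT₀d rfl χ hχ).localSplitting w₀)
          (boxSB (v.adicCompletion (maximalRealSubfield L)) (e₂ n)
            (MpPsi.toRep (localSchrodinger (maximalRealSubfield L) n T₀ v) (localSplittingCMWith L n hT₀ hT₀d hJ χ hχ v μ (ch g)) f₁) f₂) :
        SchwartzBruhat (Fin (n + n) → v.adicCompletion (maximalRealSubfield L))) :
        (Fin (n + n) → v.adicCompletion (maximalRealSubfield L)) → ℂ) 0 =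
      (((chiDet (maximalRealSubfield L) L (IsCMField.complexConj L) v n (fun w' : PlacesOver L v => (χ.localComponent w'.1)⁻¹)
            (w₀ * inlLoc (maximalRealSubfield L) L (IsCMField.complexConj L) v n hJ rfl (ch g) * w₀))⁻¹ : ℂˣ) : ℂ) *
        ((∏ w' : PlacesOver L v, Real.sqrt ‖detDelta (maximalRealSubfield L) L (IsCMField.complexConj L) v n w'
            (w₀ * inlLoc (maximalRealSubfield L) L (IsCMField.complexConj L) v n hJ rfl (ch g) * w₀)‖ : ℝ) : ℂ) *
        ((MpPsi.toRep (localSchrodinger (maximalRealSubfield L) (n + n) (gramD (maximalRealSubfield L) n T₀) v)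
            (m₀ * (localSplittingDatumCM L v μ n hT₀ hT₀d rfl χ hχ).localSplitting w₀)
            (boxSB (v.adicCompletion (maximalRealSubfield L)) (e₂ n) f₁ f₂) :
          SchwartzBruhat (Fin (n + n) → v.adicCompletion (maximalRealSubfield L))) :
          (Fin (n + n) → v.adicCompletion (maximalRealSubfield L)) → ℂ) 0 := by
  rw [localSplittingCMWith_eq_undoubleLoc, ← toRep_undoubleLoc_boxSB, ← Module.End.mul_apply, ← map_mul]
  rw [map_mul, Module.End.mul_apply]
  exact apply_zero_toRep_mul_localSplitting_eq_mul L v μ n hT₀ hT₀d χ hχ m₀ hm₀ w₀ hw₀ _ hg _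

include hm₀ hw₀ in
set_option maxHeartbeats 4000000 in -- the doubled CM datum's telescope (as ★ `LocalSplittingCMParabolicEigenfunctional`)
/-- **THE DOUBLING PRINCIPLE UPSTAIRS FOR THE CM DATUM — EXTRACTION OF AN EIGENVALUE.**  If `Σ_{i∈S} ω(s_v (ch tᵢ)) f = a • f` (`ω = toRep ∘ s_v`,
`s_v = localSplittingCMWith L n hT₀ hT₀d hJ χ hχ v μ`), every `w₀ (ch tᵢ ⊕ 1) w₀` lies in `P_Δ`, and `λ′(f ⊠ f₂) ≠ 0` for some `f₂`, then
**`a = Σ_{i∈S} e(w₀ (ch tᵢ ⊕ 1) w₀)`**, `e(p) = (chiDet χ⁻¹ p)⁻¹ · Π_{w'} √‖det_Δ p_{w'}‖`.  Road use ((L24-b), ROAD A′): `f = f₂ = 1_{𝒪^{n}}`, `S` = the Hecke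
transversal of ★ (T), `det_Δ = ϖ ∣ 1 ∣ ϖ⁻¹` by ★ (F2) + ★ (C3′), so `a = q²·e(ϖ) + (q−1) + e(ϖ⁻¹) = q(Z + Z⁻¹) + q − 1`.
[cite: Kudla1994, §3 Thm. 3.1] [cite: GelbartRogawski1991, §3.2 (3.2.2) p. 457] [cite: HarrisKudlaSweet1996, §1 (1.15)–(1.16)] -/
theorem eq_sum_scalar_of_sum_toRep_localSplittingCMWith_eq_smul {ι : Type*} (S : Finset ι) (t : ι → G)
    (ht : ∀ i ∈ S, IsSiegelDelta (maximalRealSubfield L) L (IsCMField.complexConj L) (complexConj_imagUnit L) (imagUnit_ne_zero L)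
        (imagUnit_mul_self L) v n hT₀ rfl (w₀ * inlLoc (maximalRealSubfield L) L (IsCMField.complexConj L) v n hJ rfl (ch (t i)) * w₀))
    (f : SchwartzBruhat (Fin n → v.adicCompletion (maximalRealSubfield L))) (a : ℂ)
    (hsum : ∑ i ∈ S, MpPsi.toRep (localSchrodinger (maximalRealSubfield L) n T₀ v) (localSplittingCMWith L n hT₀ hT₀d hJ χ hχ v μ (ch (t i))) f = a • f)
    (f₂ : SchwartzBruhat (Fin n → v.adicCompletion (maximalRealSubfield L)))
    (hne : ((MpPsi.toRep (localSchrodinger (maximalRealSubfield L) (n + n) (gramD (maximalRealSubfield L) n T₀) v)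
          (m₀ * (localSplittingDatumCM L v μ n hT₀ hT₀d rfl χ hχ).localSplitting w₀)
          (boxSB (v.adicCompletion (maximalRealSubfield L)) (e₂ n) f f₂) :
        SchwartzBruhat (Fin (n + n) → v.adicCompletion (maximalRealSubfield L))) :
        (Fin (n + n) → v.adicCompletion (maximalRealSubfield L)) → ℂ) 0 ≠ 0) :
    a = ∑ i ∈ S,
      (((chiDet (maximalRealSubfield L) L (IsCMField.complexConj L) v n (fun w' : PlacesOver L v => (χ.localComponent w'.1)⁻¹)
            (w₀ * inlLoc (maximalRealSubfield L) L (IsCMField.complexConj L) v n hJ rfl (ch (t i)) * w₀))⁻¹ : ℂˣ) : ℂ) *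
        ((∏ w' : PlacesOver L v, Real.sqrt ‖detDelta (maximalRealSubfield L) L (IsCMField.complexConj L) v n w'
            (w₀ * inlLoc (maximalRealSubfield L) L (IsCMField.complexConj L) v n hJ rfl (ch (t i)) * w₀)‖ : ℝ) : ℂ) := by
  -- `λ′` as a linear functional
  obtain ⟨lam, hlam⟩ : ∃ lam : SchwartzBruhat (Fin (n + n) → v.adicCompletion (maximalRealSubfield L)) →ₗ[ℂ] ℂ, ∀ Φ, lam Φ =
      ((MpPsi.toRep (localSchrodinger (maximalRealSubfield L) (n + n) (gramD (maximalRealSubfield L) n T₀) v)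
          (m₀ * (localSplittingDatumCM L v μ n hT₀ hT₀d rfl χ hχ).localSplitting w₀) Φ :
        SchwartzBruhat (Fin (n + n) → v.adicCompletion (maximalRealSubfield L))) :
        (Fin (n + n) → v.adicCompletion (maximalRealSubfield L)) → ℂ) 0 :=
    ⟨(LinearMap.proj (0 : Fin (n + n) → v.adicCompletion (maximalRealSubfield L))) ∘ₗ
        (SchwartzBruhat (Fin (n + n) → v.adicCompletion (maximalRealSubfield L))).subtype ∘ₗ
        (MpPsi.toRep (localSchrodinger (maximalRealSubfield L) (n + n) (gramD (maximalRealSubfield L) n T₀) v)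
          (m₀ * (localSplittingDatumCM L v μ n hT₀ hT₀d rfl χ hχ).localSplitting w₀)), fun _ => rfl⟩
  -- the eigen-law of `λ′` at every `tᵢ`
  have heig : ∀ i ∈ S, ∀ Φ, lam (MpPsi.toRep (localSchrodinger (maximalRealSubfield L) (n + n) (gramD (maximalRealSubfield L) n T₀) v)
      ((localSplittingDatumCM L v μ n hT₀ hT₀d rfl χ hχ).localSplitting
        (inlLoc (maximalRealSubfield L) L (IsCMField.complexConj L) v n hJ rfl (ch (t i)))) Φ) =
      ((((chiDet (maximalRealSubfield L) L (IsCMField.complexConj L) v n (fun w' : PlacesOver L v => (χ.localComponent w'.1)⁻¹)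
              (w₀ * inlLoc (maximalRealSubfield L) L (IsCMField.complexConj L) v n hJ rfl (ch (t i)) * w₀))⁻¹ : ℂˣ) : ℂ) *
          ((∏ w' : PlacesOver L v, Real.sqrt ‖detDelta (maximalRealSubfield L) L (IsCMField.complexConj L) v n w'
              (w₀ * inlLoc (maximalRealSubfield L) L (IsCMField.complexConj L) v n hJ rfl (ch (t i)) * w₀)‖ : ℝ) : ℂ)) * lam Φ := by
    intro i hi Φ
    rw [hlam, hlam, apply_zero_toRep_mul_localSplitting_eq_mul L v μ n hT₀ hT₀d χ hχ m₀ hm₀ w₀ hw₀ _ (ht i hi)]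
  have hne' : lam (boxSB (v.adicCompletion (maximalRealSubfield L)) (e₂ n) f f₂) ≠ 0 := by rwa [hlam]
  have hsum' : ∑ i ∈ S, MpPsi.toRep (localSchrodinger (maximalRealSubfield L) n T₀ v)
      (undoubleLoc (maximalRealSubfield L) L (IsCMField.complexConj L) v n hJ rfl (complexConj_imagUnit L) (imagUnit_ne_zero L)
        (imagUnit_mul_self L) hT₀ hT₀d (localSplittingDatumCM L v μ n hT₀ hT₀d rfl χ hχ).localSplitting
        (fun g => (localSplittingDatumCM L v μ n hT₀ hT₀d rfl χ hχ).proj_localSplitting g) (ch (t i))) f = a • f := by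
    rw [← localSplittingCMWith_eq_undoubleLoc]; exact hsum
  exact eq_sum_of_sum_toRep_undoubleLoc_eq_smul (maximalRealSubfield L) L (IsCMField.complexConj L) v n hJ rfl
    (complexConj_imagUnit L) (imagUnit_ne_zero L) (imagUnit_mul_self L) hT₀ hT₀d
    (localSplittingDatumCM L v μ n hT₀ hT₀d rfl χ hχ).localSplitting
    (fun g => (localSplittingDatumCM L v μ n hT₀ hT₀d rfl χ hχ).proj_localSplitting g) ch lam S t _ heig f a hsum' f₂ hne'

end CM

end Summit.HodgeConjecture.HodgeConjecture.Cruxes.HLiu418.K2LiuDoublingEigenfunctionalUpstairs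

end
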